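/-
COR-CM (cell pub-hodgecm2) — Δ2 ORIENTATION RE-KEY, branch (c-S.1): THE CONJUGATE-BIT CONFIGURATION of the theta supply guard.
Seat rekey-l0-pin-a g0 (prover-pub-hodgecm2-rekey-l0-pin-a-g0-0), 2026-08-23.  KERNEL ONLY: theorems, 0 definitions, 0 `def … : Prop`.
FRAMING: HC_CM is NOT proved; «Δ2 BRIDGE CLOSED» is NOT claimed; HELD pending orientation re-key.
-/
import Summits.HodgeConjecture.HodgeCM.Model.HypCensus.JLiuDeltaSign
import Summits.HodgeConjecture.HodgeCM.Model.Binders.JLiuLineType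
import Summits.HodgeConjecture.HodgeCM.Model.ArchLineOrientIota
import Summits.HodgeConjecture.CorCM.D2Bridge.ReflexOfTypeConj

set_option autoImplicit false

/-!
# Re-key (c-S.1): at a good context of the CONJUGATE bit the theta slots ARE `PhiMu′` lines, and the (J4a) clause holds for `adm′`

REKEY-FLIPSITES §2.2 (F-s) ∕ the ASSEMBLER's flag 2026-08-23T21:36Z: the primed reading `h418′` speaks at the lines with `ῑ₁ ∈ Φ^δ(a)`
(`PhiMu′`), whereas a good context of the sign recipe's bit OF RECORD `GoodCtx (orientBitι L ι₁) ι₁ c` has `ι₁ ∈ Φ^δ(a_i)` at its four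
slots (`GoodCtx.self_mem_lineType`) — so `h418′` is silent there (`HodgeCM.Model.not_phiMu_pin'_of_lineType_eq_slot`, sibling
`LiuDictionaryPinPrimeK0.lean`).  This file records the OTHER configuration, which the tree already supports on the census side:

* §1 `GoodCtx.im_ι₁_eta_mul_a_neg_of_not_orientBitι` — at a good context of the CONJUGATE bit `!orientBitι L ι₁` (= `orientBitι L ῑ₁`,
  ✔ `orientBitι_conjugate`), `Im ι₁(η_L · a_i) < 0` at all four slots; hence `ῑ₁ ∈ Φ^δ(a_i)` (`starRingEnd_comp_mem_lineType_of_not_orientBitι`)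
  and `ι₁ ∉ Φ^δ(a_i)`: THE SLOT LINES ARE `PhiMu′` LINES (mirror of ✔ `GoodCtx.im_ι₁_eta_mul_a_pos`, same proof at the other bit);
* §2 `GoodCtx.bar_lineType_eq_liftType_false_of_not_orientBitι` — on a Galois `L`, with the guard's `j` (`ι₁ ∘ j = c.σ`):
  `bar Φ^δ(a_i) = liftType false c.K L j ι₁ (c.Ψ i)` — so a CM record admissible THROUGH `ῑ₁` for `Φ^δ(a_i)` (`adm′`) is admissible
  through `ι₁` for `liftType false …` (✔ `D2Bridge.isReflexOfTypeG_conj_iff`, p371989) and lands at the SAME corner as today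
  (`isReflexOfTypeG_liftType_false_of_adm'`; then ✔ `isCorner_of_isReflexOfTypeG_liftType` verbatim) — the (J4a)∕`hcorner` clause of the junction;
* §3 (census side, NOTHING new — recorded as an `example`): at a NON-canonical `ι₁` (`(mk ι₁).embedding ≠ ι₁`) the four slot-positivity facts
  `0 < cmXW …` that the archimedean line datum consumes HOLD at a good context of the conjugate bit — ✔ theta-3 (U3)
  `ArchSideTerm.hpos_of_goodCtx_not_orientBitι_of_embedding_ne` (`HodgeCM/Model/ArchLineOrientIota.lean` :112), i.e. carch's CONJ BRANCH
  `hpos_iff_eq_not_orientBitι_of_goodCtx_of_embedding_ne` (`ArchKTypeOfOrient.lean` :392).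
CONSEQUENCE for the primed chain (a statement about WHERE to instantiate, not a new theorem): the supply guard of the primed END is
`GOG′ V c := (mk ι₁).embedding ≠ ι₁ ∧ GoodCtx (!orientBitι L ι₁) ι₁ c` (theta model `C.thetaModel (!orientBitι L ι₁)`, whose guard IS this
predicate by ✔ `AdelicThetaCore.thetaModel_goodCtx_iff`, stated `∀ h : Bool`), under which (i) slot positivity holds (§3), (ii) the slots are
`PhiMu′` (§1), (iii) `adm′` gives the junction's corner (§2); and `h418′` must be CONSUMED at non-canonical `ι₁` (its clause
`(mk ι₁).embedding = ι₁` flipped to `≠`, or dropped — [Liu2021] has no canonical-representative notion; Prop. 4.13 is `∀ τ′`).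
-/

noncomputable section

open NumberField NumberField.ComplexEmbedding
open Literature.AlgebraicGeometry.Motives (CMType)
open Literature.AlgebraicGeometry.ShimuraVarieties (conjRingHomK)

namespace HodgeCM.Rekey

namespace SignRecipe

namespace GoodCtx

open HodgeCM.SignRecipe HodgeCM.SignRecipe.GoodCtx
open HodgeCM.CMTypeOps (bar mem_bar_iff)

variable {L : CMField} {ι₁ : L →+* ℂ} {c : SeesawCtx L}

/-! ## §1 Slot signs at a good context of the conjugate bit -/

/-- **At a good context of the CONJUGATE bit, `Im ι₁(η_L · a_i) < 0` for every slot `i`** (the forced sign of `a_i` at `ι₁` is the indicator of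
`ι₁ ∈ Φ_{Ψ_i}^{(!h)}`; mirror of `im_ι₁_eta_mul_a_pos`). [folklore] -/
theorem im_ι₁_eta_mul_a_neg_of_not_orientBitι (hc : GoodCtx (!Model.orientBitι L ι₁) ι₁ c) (i : Fin 4) :
    (ι₁ (eta L * c.D.a i)).im < 0 := by
  obtain ⟨j, hj, hs⟩ := hc.forced
  have key : 0 < (ι₁ (c.D.a i)).re ↔ ι₁ ∈ (liftType (!Model.orientBitι L ι₁) c.K L j ι₁ (c.Ψ i)).1 :=
    signsForced_iff_rep hs i (isRep_self L ι₁)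
  rw [im_embedding_eta_mul]
  cases hb : Model.orientBitι L ι₁
  · have hι : 0 < (ι₁ (eta L)).im := (orientBitι_eq_false_iff_im_eta_pos ι₁).mp hb
    simp only [hb, Bool.not_false] at key hc
    have hmem := self_mem_bar_liftType hc hj i
    rw [mem_bar_iff] at hmem
    have hre : (ι₁ (c.D.a i)).re < 0 :=
      lt_of_le_of_ne (not_lt.mp fun h => hmem (key.mp h)) (re_embedding_ne_zero_of_conj_eq (c.D.a_real i) (c.D.a_ne i) ι₁)
    exact mul_neg_of_pos_of_neg hι hre
  · have hι : (ι₁ (eta L)).im < 0 := (orientBitι_eq_true_iff_im_eta_neg ι₁).mp hb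
    simp only [hb, Bool.not_true] at key hc
    exact mul_neg_of_neg_of_pos hι (key.mpr (self_mem_liftType hc hj i))

/-- hence **`ῑ₁ ∈ Φ^δ(a_i)`** at every slot of a good context of the conjugate bit: the slot lines are `PhiMu′` lines. [folklore] -/
theorem starRingEnd_comp_mem_lineType_of_not_orientBitι (hc : GoodCtx (!Model.orientBitι L ι₁) ι₁ c) (i : Fin 4) :
    (starRingEnd ℂ).comp ι₁ ∈ (lineType (c.D.a i) (c.D.a_real i) (c.D.a_ne i)).1 := by
  rw [mem_lineType_iff, RingHom.comp_apply, Complex.conj_im, neg_pos]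
  exact im_ι₁_eta_mul_a_neg_of_not_orientBitι hc i

/-- … and `ι₁ ∉ Φ^δ(a_i)` there (the pin of record's `PhiMu` FAILS at these slots). [folklore] -/
theorem not_self_mem_lineType_of_not_orientBitι (hc : GoodCtx (!Model.orientBitι L ι₁) ι₁ c) (i : Fin 4) :
    ι₁ ∉ (lineType (c.D.a i) (c.D.a_real i) (c.D.a_ne i)).1 := fun h =>
  lt_asymm ((mem_lineType_iff _ _ _).mp h) (im_ι₁_eta_mul_a_neg_of_not_orientBitι hc i)

/-! ## §2 The (J4a) clause for `adm′` at a good context of the conjugate bit -/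

/-- **`bar Φ^δ(a_i) = liftType false c.K L j ι₁ (c.Ψ i)`** with the guard's `j`, at a good context of the CONJUGATE bit on a Galois `L`
(mirror of `liftTyped_lineType`: there `Φ^δ(a_i)` itself is `liftType false …`). [folklore] -/
theorem bar_lineType_eq_liftType_false_of_not_orientBitι [IsGalois ℚ L] (hc : GoodCtx (!Model.orientBitι L ι₁) ι₁ c) (i : Fin 4) :
    ∃ j : c.K →+* L, ι₁.comp j = c.σ ∧
      bar (lineType (c.D.a i) (c.D.a_real i) (c.D.a_ne i)) = liftType false c.K L j ι₁ (c.Ψ i) := by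
  obtain ⟨j, hj, -, hneg, hpos⟩ := exists_liftType hc
  refine ⟨j, hj, Subtype.ext (Set.ext fun τ => ?_)⟩
  have hτ0 : (τ (eta L * c.D.a i)).im ≠ 0 := by
    rw [im_embedding_eta_mul]
    exact mul_ne_zero (embedding_eta_im_ne_zero L τ) (re_embedding_ne_zero_of_conj_eq (c.D.a_real i) (c.D.a_ne i) τ)
  rw [mem_bar_iff, mem_lineType_iff]
  have hlt : ¬ 0 < (τ (eta L * c.D.a i)).im ↔ (τ (eta L * c.D.a i)).im < 0 :=
    not_lt.trans ⟨fun h => lt_of_le_of_ne h hτ0, le_of_lt⟩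
  rw [hlt]
  cases hb : Model.orientBitι L ι₁
  · -- bit of record `false` (`0 < Im ι₁ η`), conjugate bit `true`
    have hι : 0 < (ι₁ (eta L)).im := (orientBitι_eq_false_iff_im_eta_pos ι₁).mp hb
    simp only [hb, Bool.not_false] at hneg hpos
    have h1 : τ ∈ (liftType false c.K L j ι₁ (c.Ψ i)).1 ↔ τ ∈ (bar (liftType true c.K L j ι₁ (c.Ψ i))).1 := by
      rw [mem_bar_iff, liftType_true_eq_bar_liftType_false (c.Ψ i) (orbit_of_isGalois ι₁), mem_bar_iff, not_not]
    rw [h1, ← hneg i, Set.mem_setOf_eq]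
    constructor
    · intro h; exact mul_neg_of_neg_of_pos h hι
    · intro h
      rcases mul_neg_iff.mp h with ⟨_, h2⟩ | ⟨h1, _⟩
      · exact absurd h2 (not_lt.mpr hι.le)
      · exact h1
  · -- bit of record `true` (`Im ι₁ η < 0`), conjugate bit `false`
    have hι : (ι₁ (eta L)).im < 0 := (orientBitι_eq_true_iff_im_eta_neg ι₁).mp hb
    simp only [hb, Bool.not_true] at hneg hpos
    rw [← hpos i, Set.mem_setOf_eq]
    constructor
    · intro h; exact mul_pos_of_neg_of_neg h hι
    · intro h
      rcases mul_pos_iff.mp h with ⟨_, h2⟩ | ⟨h1, _⟩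
      · exact absurd h2 (not_lt.mpr hι.le)
      · exact h1

/-- **THE CORNER INPUT FROM `adm′`**: at a good context of the conjugate bit on a Galois `L`, a CM record admissible THROUGH `ῑ₁` for the slot type
`Φ^δ(a_i)` (the primed cut `adm′`) is admissible through `ι₁` for `liftType false c.K L j ι₁ (c.Ψ i)` with the guard's `j` — the hypothesis of
✔ `isCorner_of_isReflexOfTypeG_liftType`, exactly as in the unprimed junction. [folklore] -/
theorem exists_isReflexOfTypeG_liftType_false_of_adm' [IsGalois ℚ L] (hc : GoodCtx (!Model.orientBitι L ι₁) ι₁ c) (i : Fin 4) :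
    ∃ j : c.K →+* L, ι₁.comp j = c.σ ∧ ∀ d : Model.LiuCMSide,
      d.IsReflexOfTypeG ((starRingEnd ℂ).comp ι₁) (lineType (c.D.a i) (c.D.a_real i) (c.D.a_ne i)) →
        d.IsReflexOfTypeG ι₁ (liftType false c.K L j ι₁ (c.Ψ i)) := by
  obtain ⟨j, hj, hbar⟩ := bar_lineType_eq_liftType_false_of_not_orientBitι hc i
  refine ⟨j, hj, fun d hd => ?_⟩
  rw [← hbar]
  exact (Summit.HodgeConjecture.CorCM.D2Bridge.isReflexOfTypeG_conj_iff ι₁ d _).mp hd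

end GoodCtx

end SignRecipe

/-! ## §3 Census side (nothing new): slot positivity at a NON-canonical `ι₁` under the conjugate bit -/

/-- ✔ theta-3 (U3): at a non-canonical `ι₁`, a good context of the conjugate bit has all four slot lines model-POSITIVE — the `hpos₀..₃` inputs of
`ArchSideTerm.archLineDatumOf` hold there.  Recorded to pin the name; no new content. -/
example {L : CMField} {ι₁ : L →+* ℂ} (V : HermSpace3 L ι₁) {c : SeesawCtx L}
    (hc : SignRecipe.GoodCtx (!Model.orientBitι L ι₁) ι₁ c) (hne : (InfinitePlace.mk ι₁).embedding ≠ ι₁) (i : Fin 4)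
    (hd : IsCMField.complexConj L (c.D.a i) = c.D.a i) :
    0 < Model.HypCensus.cmXW (L : Type) (Model.frameD V) (Literature.NumberTheory.GelbartRogawski1991.UnitaryDualPair.lineVec (L : Type) (c.D.a i)) (fun _ => hd) ι₁
      (Model.HypCensus.cmPlace (L : Type) ι₁) 0 :=
  Model.ArchSideTerm.hpos_of_goodCtx_not_orientBitι_of_embedding_ne V hc hne i hd

end HodgeCM.Rekey

end
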